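import Mathlib.NumberTheory.LegendreSymbol.QuadraticReciprocity
import Summits.BirchSwinnertonDyer.Rank1Residual.F1Sign2.DefiniteMod2WaldspurgerGaussianAtTwo
import HarnessLib

/-!
# AN-43 / §30.7 kernel — -an's glue `gaussianGrossPointOdd_of_parity` ((χ4♮) ⟹ (χ4♮ᵉ); crux workfile v10 f494f8e81031e88b l.1017–1021, VERBATIM) and REF1-AUDIT §270's
# kernel shadows K270.1–7 (`REF1-data/b270/Probe270_block.lean` ac889d161cbd8793, the `example`s named as theorems, one typer docstring each) for
# `F1Sign2/DefiniteMod2WaldspurgerGaussianAtTwo.lean` (typer -ty g21)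

CONTENT (all PROVED, no `sorry`, no new `def`): `gaussianGrossPointOdd_of_parity : GaussianGrossPointParity → GaussianGrossPointOddOfEvenApTwo` (REF1 A1: axioms propext /
Classical.choice / Quot.sound) · K270.1 `negOne_not_isSquare_zmod_of_three_mod_four` (Kramer Prop. 1 shadow `i_N = 0`: at the inert prime `N ≡ 3 (mod 4)`, `-1` is a non-square
unit — Mathlib `ZMod.exists_sq_eq_neg_one_iff`) · K270.2 `neg_three_pow_odd_eq_one_zmod_four` (Prop. 5 shadow `i₂ = 2·[a₂ odd]`: `Δ_min = -N^k`, `k` odd, `N ≡ 3 (4)` is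
`≡ 1 (mod 4)`, so `(Δ, -1)₂ = +1`) · K270.3 `neg_mul_neg_pow_eq_pow_succ`, `isSquare_pow_two_mul_add_two` («`-N·Δ` square ⟺ `v_N(Δ)` odd» for `Δ = -N^k`) · K270.4
`neg_natCast_mod_four_of_three_mod_four` (root number of the `-1` twist: `χ₋₄(-N) = +1`, i.e. `-N ≡ 1 (mod 4)`) · K270.5 `delta_minimalModel_11a1`, `delta_11a1_shape`,
`isSquare_neg_eleven_mul_delta_11a1` (A3 non-vacuity of the family F at `N = 11`: the minimal model `[0,-1,1,-10,-20]` of 11a1 has `Δ = -11⁵ < 0`, `-11·Δ = 1331²`,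
`11 ≡ 3 (mod 4)`; `Sel₂(11a1/ℚ) = 0` and `a₂ = -2` are census facts, not kernel facts) · K270.6 `two_pow_eq_one_or_four_of_even_le_two` (the (Kᵒ) alphabet: an 𝔽₂-space of
even dimension ≤ 2 has 1 or 4 elements) · K270.7 `odd_of_odd_add_of_even`, `even_of_odd_add_of_odd` (the glue's bookkeeping in the abstract, both directions).
BSD is not proved by this; 23715 is not closed by this.
v2 ADDENDUM (typer -ty g21): + `supersingularCongruenceEvenRank_of_rankZero : SupersingularCongruenceRankZero → SupersingularCongruenceEvenRank` ((Π) ⟹ (Πʳ);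
crux workfile v11 2f37d0d42651093c l.1082–1086, VERBATIM) + REF1 §277 K277.1 `gaussianTwistAnalyticRankZero_of_congruenceRankZero : SupersingularCongruenceRankZero → GaussianTwistAnalyticRankZeroOfEvenApTwo` ((Π) ⟹ its diagonal; `Probe277_block.lean` e1176c5cca8fc32c, VERBATIM).
v3 ADDENDUM (typer -ty g21): no glue accompanies `section V12`/`section V13` of the crux workfile (bb422d5dfac09244); appended are REF1-AUDIT §282's kernel probes K282.3–.5
(`picStep_le`, `edgeThetaDelta_one`, `bd1_body_false_at_one`, `edgeThetaKappa_one`, `v12_props_elaborate`; `REF1-data/b282/Probe282_block.lean` bd4f676b9074993e) and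
§292's K292.1–.3 (`old_iff_chi4_zero`, `v13_dichotomy`; `REF1-data/b292/Probe292_block.lean`), proofs VERBATIM, statements re-homed to this namespace.
-/

namespace Summit.BirchSwinnertonDyer.Rank1Residual.F1Sign2.ANg25.Kernel

open Literature.NumberTheory.Automorphic Literature.NumberTheory.Automorphic.Brandt
open Literature.NumberTheory.EllipticCurves
open Summit.BirchSwinnertonDyer.Rank1Residual.F1Sign2.ANg25

open scoped NumberField nonZeroDivisors Pointwise AddSubgroup

/-- (-an crux workfile v10 f494f8e81031e88b l.1017–1021, VERBATIM.) (χ4♮) restricted to `a_2` even IS (χ4♮ᵉ): kernel-checked bookkeeping (`Odd (m + a)` with `a` even ⇒ `Odd m`). -/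
theorem gaussianGrossPointOdd_of_parity (h : GaussianGrossPointParity) : GaussianGrossPointOddOfEvenApTwo := by
  intro W _ _ N hN hN4 hc hΔ hsq ha2 hr hsel k _ _ hk hdk S _ φ ψ I hx hφ hL 𝔞
  have := h W N hN hN4 hc hΔ hsq hr hsel k hk hdk S φ ψ I hx hφ hL 𝔞
  exact (Int.odd_add.mp this).mpr ha2

/-- K270.1 (REF1 §270; Kramer Prop. 1 shadow, `i_N = 0`): at a prime `p ≡ 3 (mod 4)`, `-1` is not a square mod `p`, so
`(Δ, -1)_N = (-1/N)^{v_N Δ} = -1` for odd `v_N(Δ)`. -/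
theorem negOne_not_isSquare_zmod_of_three_mod_four (p : ℕ) [Fact p.Prime] (h : p % 4 = 3) :
    ¬ IsSquare (-1 : ZMod p) := by
  rw [ZMod.exists_sq_eq_neg_one_iff]; exact fun h' => h' h

/-- K270.2 (REF1 §270; Kramer Prop. 5 shadow, `i₂ = 2·[a₂ odd]`): `Δ_min = -N^k` with `k` odd and `N ≡ 3 (mod 4)` is `≡ 1 (mod 4)`,
so `(Δ, -1)₂ = +1`. -/
theorem neg_three_pow_odd_eq_one_zmod_four (k : ℕ) : -((3 : ZMod 4) ^ (2 * k + 1)) = 1 := by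
  rw [pow_succ, pow_mul]
  have h : (3 : ZMod 4) ^ 2 = 1 := by decide
  rw [h, one_pow, one_mul]; decide

/-- K270.3a (REF1 §270; «`-N·Δ` square ⟺ `v_N(Δ)` odd» for `Δ = -N^k`): `-N·(-N^k) = N^(k+1)`. -/
theorem neg_mul_neg_pow_eq_pow_succ (N : ℚ) (k : ℕ) : -N * (-(N ^ k)) = N ^ (k + 1) := by ring

/-- K270.3b (REF1 §270): an even power is a square. -/
theorem isSquare_pow_two_mul_add_two (N : ℚ) (j : ℕ) : IsSquare (N ^ (2 * j + 2)) := ⟨N ^ (j + 1), by ring⟩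

/-- K270.4 (REF1 §270; root number of the `-1` twist: `w(W^{(-1)}) = w(W)·χ₋₄(-N)` and `χ₋₄(-N) = +1` for `N ≡ 3 (mod 4)`,
i.e. `-N ≡ 1 (mod 4)`). -/
theorem neg_natCast_mod_four_of_three_mod_four (N : ℕ) (h : N % 4 = 3) : (-(N : ℤ)) % 4 = 1 := by omega

/-- K270.5a (REF1 §270; A3 non-vacuity of the family F at `N = 11`): the minimal model `[0,-1,1,-10,-20]` of 11a1 has
`Δ = -161051` (`Sel₂(11a1/ℚ) = 0` and `a₂(11a1) = -2` are census facts, not kernel facts). -/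
theorem delta_minimalModel_11a1 : (⟨0, -1, 1, -10, -20⟩ : WeierstrassCurve ℚ).Δ = -161051 := by
  norm_num [WeierstrassCurve.Δ, WeierstrassCurve.b₂, WeierstrassCurve.b₄, WeierstrassCurve.b₆, WeierstrassCurve.b₈]

/-- K270.5b (REF1 §270): `-161051 = -11⁵` and `11 ≡ 3 (mod 4)`. -/
theorem delta_11a1_shape : (-161051 : ℤ) = -(11 ^ 5) ∧ (11 : ℕ) % 4 = 3 := by decide

/-- K270.5c (REF1 §270): `-11·Δ(11a1) = 1331²` is a square — the hypothesis `IsSquare (-(N : ℚ) * W.Δ)` of (K) at 11a1. -/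
theorem isSquare_neg_eleven_mul_delta_11a1 : IsSquare (-(11 : ℚ) * (-161051)) := ⟨1331, by norm_num⟩

/-- K270.6 (REF1 §270; the (Kᵒ) alphabet): an `𝔽₂`-space of even dimension `≤ 2` has `1` or `4` elements. -/
theorem two_pow_eq_one_or_four_of_even_le_two (s : ℕ) (hs : s ≤ 2) (he : Even s) : 2 ^ s = 1 ∨ 2 ^ s = 4 := by
  interval_cases s
  · simp
  · exact absurd he (by decide)
  · simp

/-- K270.7a (REF1 §270; the glue's bookkeeping in the abstract): `Odd (m + a)` with `a` even ⟹ `Odd m`. -/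
theorem odd_of_odd_add_of_even (m a : ℤ) (h : Odd (m + a)) (ha : Even a) : Odd m := (Int.odd_add.mp h).mpr ha

/-- K270.7b (REF1 §270; converse bookkeeping, the `a₂`-odd half of (χ4♮)): `Odd (m + a)` with `a` odd ⟹ `Even m`. -/
theorem even_of_odd_add_of_odd (m a : ℤ) (h : Odd (m + a)) (ha : Odd a) : Even m := by
  rcases Int.even_or_odd m with hm | hm
  · exact hm
  · exact absurd h (Int.not_odd_iff_even.mpr (hm.add_odd ha))

/-- (-an crux workfile v11 2f37d0d42651093c, VERBATIM.) (Π) ⇒ (Πʳ): kernel-checked bookkeeping. -/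
theorem supersingularCongruenceEvenRank_of_rankZero (h : SupersingularCongruenceRankZero) :
    SupersingularCongruenceEvenRank := by
  intro W W' _ _ _ _ N hN hN4 hc hc' hΔ hsq ha2 hr hsel hcong
  have h0 := (h W W' N hN hN4 hc hc' hΔ hsq ha2 hr hsel hcong).1
  rw [h0]; exact Even.zero

/-- (REF1-AUDIT §277 K277.1, `Probe277_block.lean` e1176c5cca8fc32c, VERBATIM.) **(Π) ⟹ its diagonal (Π∆)**: instantiate the congruence law at `W' := W`
(the congruence hypothesis is `Even 0`). -/
theorem gaussianTwistAnalyticRankZero_of_congruenceRankZero (h : SupersingularCongruenceRankZero) :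
    GaussianTwistAnalyticRankZeroOfEvenApTwo := by
  intro W _ _ N hN hN4 hc hΔ hsq ha2 hr hsel W'' _ _ C hC
  have hcong : ∀ p : ℕ, p.Prime → ¬ p ∣ 2 * N → Even (W.frobeniusTrace p - W.frobeniusTrace p) :=
    fun p _ _ => by rw [sub_self]; exact Even.zero
  exact (h W W N hN hN4 hc hc hΔ hsq ha2 hr hsel hcong).2 W'' C hC

/-! ## v3: REF1-AUDIT §282 / §292 kernel probes (K282.3–.5 from `REF1-data/b282/Probe282_block.lean` bd4f676b9074993e, K292.1–.3 from
`REF1-data/b292/Probe292_block.lean`), re-homed VERBATIM into this kernel namespace (typer -ty g21): no glue theorems accompany V12/V13 in the workfile. -/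

section REF1_282

variable {D : Type} [Ring D] [Algebra ℚ D] {k : Type} [Field k] [NumberField k]

/-- K282.3 (REF1 §282): the norm-5 translate is a sub-lattice of `J` — so `[I : picStep J] = [I : J]·25` and an iterate is never `IsEdgeCMIdeal` of the same level
(R282c(iii): do not add that as a hypothesis). -/
theorem picStep_le (ψ : k →ₐ[ℚ] D) (i₀ : k) (n : ℕ) (J : Submodule ℤ D) : picStep ψ i₀ n J ≤ J := by
  intro x hx
  have hx' : x ∈ J.toAddSubgroup ⊓ ((J.toAddSubgroup.map (AddMonoidHom.mulLeft (5 : D))).comap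
      (AddMonoidHom.mulLeft (ψ ((2 : k) ^ n * (1 - 2 * i₀))))) := hx
  exact (AddSubgroup.mem_inf.mp hx').1

/-- K282.4 (REF1 §282): at level `1` the edge theta element has one coefficient and `δ₁ = 0`. -/
theorem edgeThetaDelta_one (O : Submodule ℤ D) (φ : Brandt.ClassSet O → ℤ) (ψ : k →ₐ[ℚ] D) (i₀ : k)
    (J₀ : Submodule ℤ D) : edgeThetaDelta O φ ψ i₀ 1 J₀ = 0 := by
  simp [edgeThetaDelta]

/-- K282.4' (REF1 §282): hence the body of `EdgeThetaExactOrderOne` fails at `n = 1` (so `n₁ ≥ 2` in any theorem form). -/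
theorem bd1_body_false_at_one (O : Submodule ℤ D) (φ : Brandt.ClassSet O → ℤ) (ψ : k →ₐ[ℚ] D) (i₀ : k)
    (J₀ : Submodule ℤ D) : ¬ ¬ ((2 : ℤ) ^ (1 - 1) ∣ edgeThetaDelta O φ ψ i₀ 1 J₀) := by
  simp [edgeThetaDelta]

/-- K282.4'' (REF1 §282): and the first conjunct of `EdgeThetaExactOrderTwo` holds trivially at `n = 1` while its second fails (`κ₁ = 0`, `C(1,2) = 0`). -/
theorem edgeThetaKappa_one (O : Submodule ℤ D) (φ : Brandt.ClassSet O → ℤ) (ψ : k →ₐ[ℚ] D) (i₀ : k)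
    (J₀ : Submodule ℤ D) : edgeThetaKappa O φ ψ i₀ 1 J₀ = 0 := by
  simp [edgeThetaKappa]

/-- K282.5 (REF1 §282): the five candidate Props are well-formed terms of type `Prop` in this environment. -/
theorem v12_props_elaborate :
    [EdgeThetaMuVanishing, EdgeLevelTwoCoincidence, EdgeThetaExactOrderOne, EdgeThetaExactOrderTwo,
      EdgeThetaLambdaParity].length = 5 := rfl

end REF1_282

section REF1_292

/-- K292.1 (REF1 §292): for a character `χ` of exact order 4 of `ℤ/4` (`χ(g) = i`), `χ(θ₃) = (c₀ − c₂) + (c₁ − c₃) i` (real and imaginary parts), so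
`χ(θ₃) = 0 ⟺ c₀ = c₂ ∧ c₁ = c₃` = the typed «old» hypothesis; the conjugate character gives the same condition. -/
theorem old_iff_chi4_zero (c₀ c₁ c₂ c₃ : ℤ) : ((c₀ - c₂, c₁ - c₃) : ℤ × ℤ) = (0, 0) ↔ (c₀ = c₂ ∧ c₁ = c₃) := by
  simp only [Prod.mk.injEq]; omega

/-- K292.3 (REF1 §292): the new V13 Props resolve. -/
example : Prop := EdgeThetaOldRankTwo ∧ EdgeThetaGenericRankZero

/-- K292.2 (REF1 §292): DICHOTOMY typed by the pair of rows (same binders; hypotheses `old` / `¬ old`): rank `≥ 2` or rank `0`, never `1`. -/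
theorem v13_dichotomy (h1 : EdgeThetaOldRankTwo) (h2 : EdgeThetaGenericRankZero) :
  ∀ (W : WeierstrassCurve ℚ) [W.IsElliptic] [W.IsGloballyMinimal] (N : ℕ),
    N.Prime → N % 4 = 3 → W.conductorNorm ℤ = N → ¬ W.HasCM →
  ∀ (k : Type) [Field k] [NumberField k], IsImaginaryQuadratic k → NumberField.discr k = -4 →
  ∀ (i₀ : k), i₀ ^ 2 = -1 → ∀ (𝔭 : Ideal (𝓞 k)), 𝔭 ^ 2 = Ideal.span {(2 : 𝓞 k)} →
  ∀ (S : Brandt.XiSetup 1 N) [Fintype (Brandt.ClassSet S.O)] (φ : Brandt.ClassSet S.O → ℤ) (ψ : k →ₐ[ℚ] S.D)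
    (I : Submodule ℤ S.D), Brandt.IsGrossPoint S.O ψ I →
    φ ≠ 0 → Brandt.eigenLattice N (Brandt.matrix S.O) (fun p => W.frobeniusTrace p) = ℤ ∙ φ →
  ∀ (J₀ : Submodule ℤ S.D), IsEdgeCMIdeal S.O ψ I 𝔭 3 J₀ →
  ∀ (F : Type) [Field F] [NumberField F] [DecidableEq F] (s : F), s ^ 2 = 2 → Module.finrank ℚ F = 2 →
    (∃ P Q : ((W.baseChange F).quadraticTwist s).toAffine.Point, ∀ a b : ℤ, a • P + b • Q = 0 → a = 0 ∧ b = 0) ∨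
    (∀ P : ((W.baseChange F).quadraticTwist s).toAffine.Point, ∃ m : ℤ, m ≠ 0 ∧ m • P = 0) := by
  intro W _ _ N hN hN4 hcond hcm k _ _ hk hdk i₀ hi 𝔭 h𝔭 S _ φ ψ I hGP hφ heig J₀ hJ F _ _ _ s hs hF
  by_cases hold : (edgeThetaCoeff S.O φ ψ i₀ 3 J₀ 0 = edgeThetaCoeff S.O φ ψ i₀ 3 J₀ 2 ∧
      edgeThetaCoeff S.O φ ψ i₀ 3 J₀ 1 = edgeThetaCoeff S.O φ ψ i₀ 3 J₀ 3)
  · exact Or.inl (h1 W N hN hN4 hcond hcm k hk hdk i₀ hi 𝔭 h𝔭 S φ ψ I hGP hφ heig J₀ hJ hold.1 hold.2 F s hs hF)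
  · exact Or.inr (h2 W N hN hN4 hcond hcm k hk hdk i₀ hi 𝔭 h𝔭 S φ ψ I hGP hφ heig J₀ hJ hold F s hs hF)

end REF1_292

end Summit.BirchSwinnertonDyer.Rank1Residual.F1Sign2.ANg25.Kernel
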